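import Mathlib.Analysis.Complex.Polynomial.Basic
import Mathlib.FieldTheory.Minpoly.Field
import Literature.NumberTheory.Kottwitz1992.Involutions
import HarnessLib

/-!
# [Kottwitz1992, §2] Lemma 2.5 — DISCHARGED: `Kottwitz1992_2_5_sym_eq_real_holds`

Kernel-lane companion of the statement carpet ★ `Literature/NumberTheory/Kottwitz1992/Involutions.lean` (squad TK, TK-t01): the named
fact ★ `Involutions.Kottwitz1992_2_5_sym_eq_real` — «Let `B` be a finite-dimensional division algebra over `ℝ`, and suppose that `*` is a
positive involution of `B`. Then `B_sym = ℝ`.» — is PROVED here as `theorem Kottwitz1992_2_5_sym_eq_real_holds : Kottwitz1992_2_5_sym_eq_real D κ`.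
THEOREMS ONLY (no definition, no named fact, no `sorry`, no instance, no notation); cell hodgecm-mathlib, seat B-typ04 (g29); net debt −1.

R. E. Kottwitz, *Points on some Shimura varieties over finite fields*, J. Amer. Math. Soc. 5 (1992), §2 Lemma 2.5, p. 380 (held
`paper:doi-10-2307-2152772`, p0008 L35–L41).  THE PRINTED PROOF: «Let `x` belong to `B_sym`. Then `F := ℝ[x]` is a commutative field stable
under `*`, and `*` acts by the identity on `F`. Therefore by Lemma 2.3 the identity is a positive involution of `F`. Therefore by Lemma 2.2
`tr_{F/ℝ}(x²)` is positive for all nonzero `x` in `F`. This would not be the case if `F` were isomorphic to `ℂ`; therefore `F = ℝ`.»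
Made explicit for the tree's rendering of «positive» (condition (3) of Lemma 2.2, ★ `IsPositiveInvolution`: `*` an involution and
`tr_{B/ℝ}(x x*) > 0` for `x ≠ 0`, `tr_{B/ℝ}` = ★ `Automorphic.leftMulTrace`), with the trace taken in `B` itself so that Lemmas 2.2 and 2.3 (3)
are not needed: a symmetric `x` is integral over `ℝ` (`B` is finite-dimensional) with irreducible minimal polynomial `p` (`B` is a division
ring), hence `deg p ≤ 2` (Mathlib ★ `Irreducible.natDegree_le_two`, the fundamental theorem of algebra).  If `deg p = 1` then `x ∈ ℝ`
(★ `minpoly.mem_range_of_degree_eq_one`).  If `p = X² + bX + c`, then `b² < 4c` (a real root would make `p` reducible,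
★ `Polynomial.degree_eq_one_of_irreducible_of_root`), and `y = q(x)` with `q = (4c − b²)^{−1/2} (2X + b)` satisfies `q² = 4s²·p − 1`, so
`y² = −1` — «`F` isomorphic to `ℂ`» —, and `y* = y` because `*` fixes every polynomial in the symmetric `x` (`(x^n)* = (x*)^n`, `1* = 1` in a
division ring).  Positivity at `y ≠ 0` gives `0 < tr_{B/ℝ}(y y*) = tr_{B/ℝ}(−1) = −dim_ℝ B ≤ 0`, a contradiction.  Conversely `ℝ ⊆ B_sym` as
`(r·1)* = r·1* = r·1`.
HONEST LABEL: HC_CM is proved only modulo the 7 printed citations (2 remaining: hLiu418, h413) until rung 0 closes; this file adds no citation debt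
(0 facts, 0 sorry) and discharges 1 named fact of ★ `Involutions`.

## References
* [Kottwitz1992] R. E. Kottwitz, Points on some Shimura varieties over finite fields, J. Amer. Math. Soc. 5 (1992) 373–444, §2 Lemma 2.5
  p. 380; Definition of «positive» = Lemma 2.2 (3) p. 379–380; §1 p. 378 (involutions).
-/

noncomputable section

open Polynomial

namespace Literature.NumberTheory.Kottwitz1992.Involutions

open Literature.NumberTheory.Automorphic (leftMulTrace leftMulTrace_apply)

universe u

section LemmaTwoFive

variable (D : Type u) [DivisionRing D] [Algebra ℝ D] (κ : D →ₗ[ℝ] D)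

/-- An involution of a division algebra fixes `1` (`κ1 = κ1·κ1` and `κ1 ≠ 0`). [cite: Kottwitz1992, §1 (p. 378)] -/
private theorem apply_one (hκ : IsInvolution ℝ D κ) : κ 1 = 1 := by
  have h : κ 1 = κ 1 * κ 1 := by simpa using hκ.map_mul 1 1
  have h0 : κ 1 ≠ 0 := by
    intro h0
    have h1 := hκ.apply_apply 1
    rw [h0, map_zero] at h1
    exact one_ne_zero h1.symm
  exact (mul_left_cancel₀ h0 (by rw [mul_one]; exact h.symm))

/-- An involution fixing `x` fixes every polynomial in `x`. [folklore] -/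
private theorem apply_aeval (hκ : IsInvolution ℝ D κ) {x : D} (hx : κ x = x) (q : ℝ[X]) : κ (aeval x q) = aeval x q := by
  have hpow : ∀ n : ℕ, κ (x ^ n) = x ^ n := by
    intro n
    induction n with
    | zero => rw [pow_zero, apply_one D κ hκ]
    | succ n ih => rw [pow_succ, hκ.map_mul, hx, ih, ← pow_succ', pow_succ]
  rw [aeval_eq_sum_range, map_sum]
  refine Finset.sum_congr rfl fun n _ => ?_
  rw [map_smul, hpow]

/-- **Lemma 2.5, PROVED**: ★ `Kottwitz1992_2_5_sym_eq_real` holds — «Let `B` be a finite-dimensional division algebra over `ℝ`,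
and suppose that `*` is a positive involution of `B`. Then `B_sym = ℝ`.»  Proof: a symmetric `x` has an irreducible real minimal
polynomial, of degree `≤ 2` (Mathlib ★ `Irreducible.natDegree_le_two`); degree `1` means `x ∈ ℝ`; a degree-`2` factor `X² + bX + c`
(`b² < 4c`) would give the symmetric element `y = (2x + b)/√(4c − b²) ∈ ℝ[x]` with `y² = −1`, whence
`tr_{B/ℝ}(y y*) = tr_{B/ℝ}(−1) = −dim_ℝ B < 0`, contradicting positivity. [cite: Kottwitz1992, Lemma 2.5 (p. 380)] -/
theorem Kottwitz1992_2_5_sym_eq_real_holds : Kottwitz1992_2_5_sym_eq_real D κ := by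
  intro hfd hpos
  haveI : FiniteDimensional ℝ D := hfd
  have hκ : IsInvolution ℝ D κ := hpos.toIsInvolution
  ext x
  refine ⟨fun hx => ?_, ?_⟩
  · change κ x = x at hx
    have hint : IsIntegral ℝ x := IsIntegral.of_finite ℝ x
    have hirr : Irreducible (minpoly ℝ x) := minpoly.irreducible hint
    have hmonic : (minpoly ℝ x).Monic := minpoly.monic hint
    have hdeg2 : (minpoly ℝ x).natDegree ≤ 2 := hirr.natDegree_le_two
    have hdeg1 : 0 < (minpoly ℝ x).natDegree := minpoly.natDegree_pos hint
    rcases Nat.lt_or_ge (minpoly ℝ x).natDegree 2 with hlt | hge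
    · -- degree `1`: `x ∈ ℝ`
      have h1 : (minpoly ℝ x).degree = 1 := by
        rw [degree_eq_natDegree hirr.ne_zero]
        have : (minpoly ℝ x).natDegree = 1 := by omega
        rw [this]
        rfl
      obtain ⟨r, hr⟩ := RingHom.mem_range.mp (minpoly.mem_range_of_degree_eq_one ℝ x h1)
      exact ⟨r, hr⟩
    · -- degree `2`: a symmetric square root of `−1`, contradiction
      exfalso
      have h2 : (minpoly ℝ x).natDegree = 2 := le_antisymm hdeg2 hge
      set p := minpoly ℝ x with hp
      set b := p.coeff 1 with hb
      set c := p.coeff 0 with hc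
      have hc2 : p.coeff 2 = 1 := by rw [← h2]; exact hmonic.coeff_natDegree
      have hpeq : p = X ^ 2 + C b * X + C c := by
        conv_lhs => rw [p.as_sum_range_C_mul_X_pow, h2]
        simp only [Finset.sum_range_succ, Finset.sum_range_zero, zero_add, pow_zero, mul_one, pow_one, hc2, map_one, one_mul]
        ring
      -- the discriminant is negative (else a real root, and `p` of degree `2` would not be irreducible)
      have hdisc : b ^ 2 - 4 * c < 0 := by
        by_contra hge0
        push Not at hge0
        set t := Real.sqrt (b ^ 2 - 4 * c) with ht
        have htt : t * t = b ^ 2 - 4 * c := Real.mul_self_sqrt hge0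
        have hroot : p.IsRoot ((-b + t) / 2) := by
          rw [IsRoot, hpeq]
          simp only [eval_add, eval_pow, eval_X, eval_mul, eval_C]
          linear_combination (1 / 4 : ℝ) * htt
        have hd1 := degree_eq_one_of_irreducible_of_root hirr hroot
        rw [degree_eq_natDegree hirr.ne_zero, h2] at hd1
        exact absurd hd1 (by decide)
      have hdpos : 0 < 4 * c - b ^ 2 := by linarith
      set s := (Real.sqrt (4 * c - b ^ 2))⁻¹ with hs
      have hss : s * s * (4 * c - b ^ 2) = 1 := by
        rw [hs, ← mul_inv, Real.mul_self_sqrt hdpos.le, inv_mul_cancel₀ hdpos.ne']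
      -- `y = s (2x + b) ∈ ℝ[x]`
      set q : ℝ[X] := C s * (C 2 * X + C b) with hq
      have hqq : q * q = C (4 * s * s) * p - 1 := by
        rw [hpeq, hq]
        have h1 : (1 : ℝ[X]) = C (s * s * (4 * c - b ^ 2)) := by rw [hss, map_one]
        rw [h1]
        simp only [map_mul, map_sub, map_pow, map_ofNat]
        ring
      set y : D := aeval x q with hy
      have hyy : y * y = -1 := by
        rw [hy, ← map_mul, hqq, map_sub, map_mul, hp, minpoly.aeval, mul_zero, map_one, zero_sub]
      have hy0 : y ≠ 0 := by
        intro h0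
        rw [h0, mul_zero] at hyy
        exact one_ne_zero (neg_eq_zero.mp hyy.symm)
      have hκy : κ y = y := apply_aeval D κ hκ hx q
      have hposy := hpos.trace_mul_self_pos y hy0
      rw [hκy, hyy, leftMulTrace_apply, map_neg, map_one, map_neg, LinearMap.trace_one] at hposy
      have hnn : (0 : ℝ) ≤ (Module.finrank ℝ D : ℝ) := Nat.cast_nonneg _
      linarith
  · rintro ⟨r, rfl⟩
    change κ (algebraMap ℝ D r) = algebraMap ℝ D r
    rw [Algebra.algebraMap_eq_smul_one, map_smul, apply_one D κ hκ]

end LemmaTwoFive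

end Literature.NumberTheory.Kottwitz1992.Involutions

end
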